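import Summits.BirchSwinnertonDyer.BirchSwinnertonDyer.Theorems.QuadraticBranchSignedControlPlusEtaNonsurjCartanFieldCMField
import Summits.BirchSwinnertonDyer.BirchSwinnertonDyer.Theorems.QuadraticBranchSignedControlPlusEtaNonsurjCartanFieldFrobenius
import Literature.NumberTheory.EllipticCurves.Gross2004.RationalCharacterFrobeniusProofs
import Literature.NumberTheory.EllipticCurves.QuadraticTwistFramedTorsion
import Literature.NumberTheory.GaloisRepresentations.HeckeCharacterProofs
import Literature.NumberTheory.GaloisRepresentations.IntegralGaloisActionProofs
import HarnessLib

/-!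
# Route `QuadraticBranchSignedControl` (rung K8, cell `bsd-potss`): crux stmt-BirchSwinnertonDyer-19606
# `PlusEtaMainConjectureNonsurj` — THE ARITHMETIC CERTIFICATE «NO CM-CURVE ANCHOR» IN FULL: nine good primes `ℓ_d` with
# `p ∤ a_{ℓ_d}(V)` and `(d/ℓ_d) = −1`, one per class-number-one discriminant `d`, put the row in the v7 stub «uncongruent»

WHAT. `…CartanFieldCMField` (this seat) proved: a CM-curve anchor `A` of a row `V` of crux 19606 forces `H_V = Stab(√d_K)`,
`d_K = cmFieldDiscrOfJ (j A)` one of the nine class-number-one discriminants, and gave the door `not_exists_cmAnchor_of_forall_nine`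
with GALOIS witnesses. `…CartanFieldFrobenius` (g9) proved `p ∤ a_ℓ(V) ⟹ Frob_ℓ ∈ H_V`. The tree's Gross-2004 dictionary
(`IsRationalCharacterFor.coe_apply_eq_jacobiSym_of_isArithFrobAt`: a quadratic Kummer character takes the value `(d/ℓ)` on an
arithmetic Frobenius at `ℓ ∤ 2d`) turns the witnesses into ARITHMETIC ones:

* §1 `smul_geomSqrt_eq_iff_jacobiSym_eq_one`: for an odd prime `ℓ ∤ d` and an arithmetic Frobenius `σ` at a prime of `ℤ̄`
  above `ℓ`: `σ√d = √d ⟺ (d/ℓ) = 1` (the decomposition law of `ℚ(√d)`, Neukirch I (8.5), via Gross's dictionary).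
* §2 `not_modPCongruent_of_hasCM_of_frob_jacobiSym`: a good prime `ℓ ≠ 2, p` of the row with `p ∤ a_ℓ(V)` and
  `(d_K(A)/ℓ) = −1` excludes the CM curve `A` as an anchor (`Frob_ℓ ∈ H_V` but `Frob_ℓ √d_K = −√d_K`).
* §3 **`not_exists_cmAnchor_of_nine_frob`**: nine such primes, one for each `d ∈ {−3, −4, −7, −8, −11, −19, −43, −67, −163}`,
  certify VERBATIM the negated existential of `Sig.stub_etaMC_nonCM_uncongruent` («no globally minimal CM curve, good at `p`
  with `a_p = 0`, is mod-`p` congruent to `V`»). Such primes exist for every row whose Cartan field is none of the nine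
  (Chebotarev; g5/g10/g13 census at `p = 5`, height ≤ 20: 304/336 rows, all with `h(K_V) > 1`), and are found among the
  first few good primes — a per-row KERNEL RECORD needs only nine values `a_ℓ(V) mod p`.

HONEST FRAMING (cell `bsd-potss`, run/shared/lean/pub/bsd-potss/; FULL-BSD rank ≤ 1 programme): TOOL THEOREMS ONLY (no definition,
no named fact, no `sorry`, axioms standard). Nothing is booked; crux 19606 stays OPEN (membership in the uncongruent stub is a
CLASSIFICATION of a row, not a proof of (C1⁺_η) for it); `BSD(W, p)` is claimed for no pair. Seat `bsd-potss-k8eta-c2` g14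
(prover), `--supports stmt-BirchSwinnertonDyer-19606`.

References: [Gross2004] §2 p. 40 (rational characters); [NeukirchANT1999] Ch. I §8 (8.5); [Serre1972] §2.2, §4.5;
[Serre1981] §8.1 (238); [Lang1987] Ch. 10 §4.
-/

set_option autoImplicit false
set_option linter.dupNamespace false

noncomputable section

open scoped Classical NumberField

open Field IsDedekindDomain NumberField WeierstrassCurve Literature.NumberTheory.EllipticCurves
  Literature.NumberTheory.EllipticCurves.Gross2004 Literature.NumberTheory.GaloisRepresentations
  Literature.NumberTheory.SerreUniformity Literature.NumberTheory.EllipticCurves.Rank1Residual Rat.HeightOneSpectrum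
open Summit.BirchSwinnertonDyer.Rank1Residual.O6 (ModPCongruent)

namespace Summit.BirchSwinnertonDyer.BirchSwinnertonDyer.Theorems.EtaCartanField

/-! ## §1 An arithmetic Frobenius at `ℓ ∤ 2d` fixes `√d` iff `(d/ℓ) = 1` -/

/-- **The Kummer character of `√d` is a rational character for `d`** in the sense of the tree's Gross-2004 dictionary
(`IsRationalCharacterFor`): the continuous quadratic character `χ_d : Γ_ℚ → ℂˣ` of `exists_continuousQuadraticCharacter`
takes the value `1` or `−1` at `γ` according as `γ√d = ±√d`. [cite: Gross2004, §2 p. 40 (rational characters; unfolding)] -/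
theorem exists_isRationalCharacterFor_intCast {d : ℤ} (hd : d ≠ 0) :
    ∃ χ : absoluteGaloisGroup ℚ →ₜ* ℂˣ, IsRationalCharacterFor χ d ∧
      ∀ γ : absoluteGaloisGroup ℚ, χ γ = 1 ↔ γ • geomSqrt (d : ℚ) = geomSqrt (d : ℚ) := by
  have hd0 : (d : ℚ) ≠ 0 := by exact_mod_cast hd
  obtain ⟨χ, h1, h2, -⟩ := exists_continuousQuadraticCharacter hd0 ℂ
  have hne : geomSqrt (d : ℚ) ≠ -geomSqrt (d : ℚ) := geomSqrt_ne_neg hd0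
  have hsq : geomSqrt (d : ℚ) ^ 2 = ((d : ℤ) : AlgebraicClosure ℚ) := by
    rw [geomSqrt_sq, map_intCast]
  refine ⟨χ, ⟨geomSqrt (d : ℚ), hsq, fun γ => ?_⟩, fun γ => ⟨fun h => ?_, h1 γ⟩⟩
  · rcases smul_geomSqrt_eq_or γ (d : ℚ) with hγ | hγ
    · rw [if_pos hγ, h1 γ hγ, Units.val_one]
    · have hγ' : ¬ γ • geomSqrt (d : ℚ) = geomSqrt (d : ℚ) := by rw [hγ]; exact fun h => hne h.symm
      rw [if_neg hγ', h2 γ hγ, Units.val_neg, Units.val_one]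
  · rcases smul_geomSqrt_eq_or γ (d : ℚ) with hγ | hγ
    · exact hγ
    · exfalso
      rw [h2 γ hγ] at h
      have h' := congrArg (fun u : ℂˣ => (u : ℂ)) h
      norm_num at h'

/-- **Decomposition law of `ℚ(√d)` on Frobenius elements.** For `d ∈ ℤ`, an odd prime `ℓ ∤ d`, a prime `𝔓` of `ℤ̄` above `ℓ`
and an arithmetic Frobenius `σ` at `𝔓`: `σ√d = √d ⟺ (d/ℓ) = 1` (and otherwise `σ√d = −√d`, `(d/ℓ) = −1`). From the tree's
`IsRationalCharacterFor.coe_apply_eq_jacobiSym_of_isArithFrobAt` (`χ_d(Frob_ℓ) = (d/ℓ)`, Euler's criterion mod `𝔓`).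
[cite: NeukirchANT1999, Ch. I §8 Prop. (8.5)] [cite: Gross2004, §2 p. 40 (rational characters ↔ factorizations D = d₁d₂)] -/
theorem smul_geomSqrt_eq_iff_jacobiSym_eq_one {d : ℤ} (hd : d ≠ 0) {ℓ : ℕ} [hℓ : Fact ℓ.Prime] (hℓ2 : ℓ ≠ 2)
    (hℓd : ¬ (ℓ : ℤ) ∣ d) {v : HeightOneSpectrum (𝓞 ℚ)} (hv : (primesEquiv v : ℕ) = ℓ)
    {𝔓 : Ideal (absIntegers (𝓞 ℚ) ℚ)} (h𝔓 : 𝔓 ∈ v.primesAbove) {σ : absoluteGaloisGroup ℚ}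
    (hσ : IsArithFrobAt (𝓞 ℚ) σ 𝔓) :
    σ • geomSqrt (d : ℚ) = geomSqrt (d : ℚ) ↔ jacobiSym d ℓ = 1 := by
  obtain ⟨χ, hrat, hiff⟩ := exists_isRationalCharacterFor_intCast hd
  have hgen : natGenerator v = ℓ := hv
  have h2v : (2 : 𝓞 ℚ) ∉ v.asIdeal := by
    intro h
    have h' : ((2 : ℕ) : 𝓞 ℚ) ∈ v.asIdeal := by simpa using h
    rw [Rat.natCast_mem_asIdeal_iff v, hgen, Nat.dvd_prime Nat.prime_two] at h'
    rcases h' with h' | h'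
    · exact hℓ.out.one_lt.ne' h'
    · exact hℓ2 h'
  have hdv : ((d : ℤ) : 𝓞 ℚ) ∉ v.asIdeal := by
    rw [Rat.intCast_mem_asIdeal_iff v, hgen]
    exact hℓd
  have hval := hrat.coe_apply_eq_jacobiSym_of_isArithFrobAt h2v hdv h𝔓 hσ
  rw [Rat.residueCard_eq_natGenerator, hgen] at hval
  rw [← hiff σ]
  constructor
  · intro h
    rw [h, Units.val_one] at hval
    exact_mod_cast hval.symm
  · intro h
    rw [h, Int.cast_one] at hval
    exact Units.ext hval

/-- If `(d/ℓ) = −1` then `ℓ ∤ d` (bookkeeping: `(d/ℓ) = 0` when `ℓ ∣ d`). [folklore] -/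
private theorem not_dvd_of_jacobiSym_eq_neg_one {d : ℤ} {ℓ : ℕ} [hℓ : Fact ℓ.Prime] (hj : jacobiSym d ℓ = -1) :
    ¬ (ℓ : ℤ) ∣ d := by
  intro hdvd
  rw [jacobiSym.mod_left, Int.emod_eq_zero_of_dvd hdvd, jacobiSym.zero_left hℓ.out.one_lt] at hj
  exact absurd hj (by decide)

/-! ## §2 A Frobenius certificate against one CM curve -/

/-- **A good prime `ℓ ≠ 2, p` with `p ∤ a_ℓ(V)` and `(d_K(A)/ℓ) = −1` excludes the CM curve `A` as an anchor of the row `V`.**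
(`Frob_ℓ ∈ H_V` by `centralizes_sq_frob_of_not_dvd_frobeniusTrace`; a CM anchor would force `H_V = Stab(√d_K)`
(`centralizes_sq_iff_smul_geomSqrt_of_cmAnchor_of_row`), but `Frob_ℓ` moves `√d_K` by §1.) No hypothesis on `A` beyond CM.
[cite: Serre1972, §4.5] [cite: Serre1981, §8.1 (238)] [cite: NeukirchANT1999, Ch. I §8 Prop. (8.5)] -/
theorem not_modPCongruent_of_hasCM_of_frob_jacobiSym (V : WeierstrassCurve ℚ) [V.IsElliptic] [V.IsGloballyMinimal]
    (p : ℕ) [Fact p.Prime] (hp5 : 5 ≤ p) (hgood : V.HasGoodReductionAtPrime p) (hap : V.frobeniusTrace p = 0)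
    (hns : ¬ ∀ m : ℕ, V.HasSurjectiveModNGaloisRep (p ^ m : ℕ)) {A : WeierstrassCurve ℚ} [A.IsElliptic] (hCM : A.HasCM)
    (ℓ : ℕ) [hℓ : Fact ℓ.Prime] (hℓp : ℓ ≠ p) (hℓ2 : ℓ ≠ 2) (hgoodℓ : V.HasGoodReductionAtPrime ℓ)
    (ha : ¬ (p : ℤ) ∣ V.frobeniusTrace ℓ) (hj : jacobiSym (cmFieldDiscrOfJ A.j) ℓ = -1) : ¬ ModPCongruent V A p := by
  intro hVA
  have hp2 : p ≠ 2 := by omega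
  obtain ⟨v, hv⟩ : ∃ v : HeightOneSpectrum (𝓞 ℚ), (primesEquiv v : ℕ) = ℓ :=
    ⟨primesEquiv.symm ⟨ℓ, hℓ.out⟩, by rw [Equiv.apply_symm_apply]⟩
  obtain ⟨𝔓, h𝔓⟩ := v.primesAbove_nonempty
  obtain ⟨σ, hσ⟩ := HeightOneSpectrum.exists_isArithFrobAt_of_mem_primesAbove_holds h𝔓
  have hfrob := centralizes_sq_frob_of_not_dvd_frobeniusTrace V hp2
    (hasModPImageEqNonsplitCartanNormalizer_of_row V p hp5 hgood hap hns) ℓ hℓp hgoodℓ ha hv h𝔓 hσ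
  have hfix := (centralizes_sq_iff_smul_geomSqrt_of_cmAnchor_of_row V p hp5 hgood hap hns hCM hVA σ).mp hfrob
  have hd0 : cmFieldDiscrOfJ A.j ≠ 0 := (cmFieldDiscrOfJ_neg_of_hasCM A hCM).ne
  have h1 := (smul_geomSqrt_eq_iff_jacobiSym_eq_one hd0 hℓ2 (not_dvd_of_jacobiSym_eq_neg_one hj) hv h𝔓 hσ).mp hfix
  rw [h1] at hj
  exact absurd hj (by decide)

/-! ## §3 Nine primes: the row lies in the v7 stub «uncongruent» -/

/-- Symmetry of mod-`p` congruence (bookkeeping). [folklore] -/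
private theorem modPCongruent_symm'' {W W' : WeierstrassCurve ℚ} {q : ℕ} (h : ModPCongruent W W' q) :
    ModPCongruent W' W q := by
  obtain ⟨e, he⟩ := h
  refine ⟨e.symm, fun σ P => e.injective ?_⟩
  rw [e.apply_symm_apply, he, e.apply_symm_apply]

/-- **Nine Frobenius primes certify «no CM-curve anchor».** Let `V` be a row of crux 19606 at `p`. If for each of the nine
class-number-one discriminants `d` there is a prime `ℓ ≠ 2, p` of good reduction for `V` with `p ∤ a_ℓ(V)` and `(d/ℓ) = −1`
(`ℓ` splits in `K_V` but is inert in `ℚ(√d)`), then NO globally minimal CM curve good at `p` with `a_p = 0` — indeed no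
elliptic curve with CM at all — is mod-`p` congruent to `V`: the negated existential of `Sig.stub_etaMC_nonCM_uncongruent`,
verbatim. The arithmetic form of `not_exists_cmAnchor_of_forall_nine`. [cite: Serre1972, §4.5] [cite: NeukirchANT1999, Ch. I §8 Prop. (8.5)] -/
theorem not_exists_cmAnchor_of_nine_frob (V : WeierstrassCurve ℚ) [V.IsElliptic] [V.IsGloballyMinimal]
    (p : ℕ) [Fact p.Prime] (hp5 : 5 ≤ p) (hgood : V.HasGoodReductionAtPrime p) (hap : V.frobeniusTrace p = 0)
    (hns : ¬ ∀ m : ℕ, V.HasSurjectiveModNGaloisRep (p ^ m : ℕ))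
    (h : ∀ d ∈ ({-3, -4, -7, -8, -11, -19, -43, -67, -163} : Finset ℤ), ∃ (ℓ : ℕ) (_ : Fact ℓ.Prime),
      ℓ ≠ p ∧ ℓ ≠ 2 ∧ V.HasGoodReductionAtPrime ℓ ∧ ¬ (p : ℤ) ∣ V.frobeniusTrace ℓ ∧ jacobiSym d ℓ = -1) :
    ¬ ∃ (V'' : WeierstrassCurve ℚ) (_ : V''.IsElliptic) (_ : V''.IsGloballyMinimal),
        V''.HasCM ∧ V''.HasGoodReductionAtPrime p ∧ V''.frobeniusTrace p = 0 ∧ ModPCongruent V'' V p := by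
  rintro ⟨A, _, _, hCM, -, -, hAV⟩
  obtain ⟨ℓ, _, hℓp, hℓ2, hgoodℓ, ha, hj⟩ := h _ (cmFieldDiscrOfJ_mem_nine_of_hasCM A hCM)
  exact not_modPCongruent_of_hasCM_of_frob_jacobiSym V p hp5 hgood hap hns hCM ℓ hℓp hℓ2 hgoodℓ ha hj
    (modPCongruent_symm'' hAV)

end Summit.BirchSwinnertonDyer.BirchSwinnertonDyer.Theorems.EtaCartanField

end
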